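import Literature.Probability.Process.StableLikeJumpChainBasic
import Literature.Probability.Process.StableLikeJumpChainDiag
import Literature.Probability.Process.StableLikeJumpChainLowerOff
import Literature.Probability.Process.StableLikeJumpChainTightBound
import HarnessLib

/-!
# Bass–Levin 2002, Theorem 1.1: assembly of the two-sided bounds

Support file for the proof of Bass–Levin 2002, Theorem 1.1
(`Literature.Probability.Process.bassLevin_thm_1_1`, file `StableLikeJumpChain.lean`).

* `tight_of_moment` : a `β`-moment bound `∑_z Q k x z (1+‖z−x‖)^β ≤ U k^{β/α}` gives the
  tightness-with-rate bound `∑_{‖z−x‖>r} Q k x z ≤ U k^{β/α} r^{-β}` consumed below;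
* `kpow_two_sided_of_tight` : for a reversible stable-like Markov kernel on `ℤ^d` (the interface
  produced by `exists_kernel_package`), the tightness-with-rate bound implies the two-sided
  estimate of Bass–Levin Thm 1.1 in terms of `heatKernelShape`:
  upper bound from `kpow_diag_bound` (Thm 4.3) and `kpow_offdiag_bound` (Thm 4.9);
  lower bound from `kpow_near_diag_lower` (Prop. 5.1) and `kpow_offdiag_lower` (Thm 5.2), the
  tail input of which is supplied by the upper bound (`kpow_far_le_of_offdiag`).

* `bassLevin_thm_1_1_holds` : the **discharge** of the named fact: for the conductance chain
  `jumpChainProb C` the kernel package is `exists_kernel_package`, the on-diagonal bound is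
  `kpow_diag_bound`, and the tightness input is the Nash moment/tail bound `tail_bound`
  (`StableLikeJumpChainTightBound`, replacing Bass–Levin Thm 2.8).

## References
* R. F. Bass, D. A. Levin, *Transition probabilities for symmetric jump processes*,
  Trans. Amer. Math. Soc. 354 (2002) 2933–2953, Thm 1.1 and §§4–5.
-/

noncomputable section

namespace Literature.Probability.Process

open scoped BigOperators

variable {d : ℕ} {P : (Fin d → ℤ) → (Fin d → ℤ) → ℝ}
  {Q : ℕ → (Fin d → ℤ) → (Fin d → ℤ) → ℝ} {μ : (Fin d → ℤ) → ℝ} {m M c₁ c₂ α : ℝ}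

/-- **Tightness from a moment bound**: if `∑_z Q k x z (1+‖z−x‖)^β ≤ U k^{β/α}` (`k ≥ 1`,
`β ≥ 0`, summable family), then `∑_{‖z−x‖>r} Q k x z ≤ U k^{β/α} r^{-β}` for `r > 0`
(Chebyshev). [folklore] -/
theorem tight_of_moment (hP0 : ∀ x y, 0 ≤ P x y)
    (hQ0 : ∀ x y, Q 0 x y = if x = y then 1 else 0)
    (hQ : ∀ n x y, Q (n + 1) x y = ∑' z, Q n x z * P z y)
    {β U : ℝ} (hβ : 0 ≤ β)
    (hmom : ∀ (k : ℕ) (x : Fin d → ℤ), 1 ≤ k →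
      (Summable fun z => Q k x z * (1 + ‖z - x‖) ^ β) ∧
        ∑' z, Q k x z * (1 + ‖z - x‖) ^ β ≤ U * (k : ℝ) ^ (β / α))
    (k : ℕ) (x : Fin d → ℤ) (r : ℝ) (hk : 1 ≤ k) (hr : 0 < r) :
    ∑' z, {z | r < ‖z - x‖}.indicator (Q k x) z ≤ U * (k : ℝ) ^ (β / α) * r ^ (-β) := by
  have hQnn : ∀ k x w, 0 ≤ Q k x w := kpow_nonneg hP0 hQ0 hQ
  obtain ⟨hs, hle⟩ := hmom k x hk
  have hrβ : 0 < r ^ (-β) := Real.rpow_pos_of_pos hr _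
  have hpt : ∀ z, {z | r < ‖z - x‖}.indicator (Q k x) z ≤
      Q k x z * (1 + ‖z - x‖) ^ β * r ^ (-β) := by
    intro z
    by_cases hz : z ∈ {z | r < ‖z - x‖}
    · rw [Set.indicator_of_mem hz]
      have hz' : r < ‖z - x‖ := hz
      have h1 : 1 ≤ (1 + ‖z - x‖) ^ β * r ^ (-β) := by
        rw [Real.rpow_neg hr.le, ← div_eq_mul_inv, one_le_div (Real.rpow_pos_of_pos hr β)]
        exact Real.rpow_le_rpow hr.le (by linarith) hβ
      calc Q k x z = Q k x z * 1 := (mul_one _).symm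
        _ ≤ Q k x z * ((1 + ‖z - x‖) ^ β * r ^ (-β)) := mul_le_mul_of_nonneg_left h1 (hQnn k x z)
        _ = Q k x z * (1 + ‖z - x‖) ^ β * r ^ (-β) := by ring
    · rw [Set.indicator_of_notMem hz]
      exact mul_nonneg (mul_nonneg (hQnn k x z) (Real.rpow_nonneg (by positivity) _)) hrβ.le
  have hsum : Summable (Q k x) := by
    refine hs.of_nonneg_of_le (fun z => hQnn k x z) (fun z => ?_)
    exact le_mul_of_one_le_right (hQnn k x z) (Real.one_le_rpow (by linarith [norm_nonneg (z - x)]) hβ)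
  calc ∑' z, {z | r < ‖z - x‖}.indicator (Q k x) z
      ≤ ∑' z, Q k x z * (1 + ‖z - x‖) ^ β * r ^ (-β) :=
        Summable.tsum_le_tsum hpt (hsum.indicator _) (hs.mul_right _)
    _ = (∑' z, Q k x z * (1 + ‖z - x‖) ^ β) * r ^ (-β) := tsum_mul_right
    _ ≤ U * (k : ℝ) ^ (β / α) * r ^ (-β) := mul_le_mul_of_nonneg_right hle hrβ.le

/-- **Two-sided bounds from tightness (Bass–Levin Thm 1.1 for a stable-like kernel).** For a
Markov kernel `P` on `ℤ^d` (`d ≥ 1`, `α > 0`), reversible with respect to weights in `[m, M]`,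
with `c₁ ‖x−y‖^{-(d+α)} ≤ P x y ≤ c₂ ‖x−y‖^{-(d+α)}`, whose powers `Q` satisfy the tightness
bound `∑_{‖z−x‖>r} Q k x z ≤ U k^{β/α} r^{-β}` (`k ≥ 1`, `r > 0`, some `β > 0`): there are
`C, c > 0` with `Q n x y ≤ C · heatKernelShape d α n x y` for `n ≥ 1` and
`c · heatKernelShape d α n x y ≤ Q n x y` for `n ≥ 2` and for `n = 1`, `x ≠ y`.
[cite: BassLevin2002, Thm 1.1] -/
theorem kpow_two_sided_of_tight (hd : 1 ≤ d) (hα : 0 < α) (hP0 : ∀ x y, 0 ≤ P x y)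
    (hP1 : ∀ x, HasSum (P x) 1)
    (hμ : ∀ x, m ≤ μ x ∧ μ x ≤ M) (hm : 0 < m)
    (hrev : ∀ x y, μ x * P x y = μ y * P y x)
    (hlb : ∀ x y, c₁ * ‖x - y‖ ^ (-((d : ℝ) + α)) ≤ P x y) (hc₁ : 0 < c₁)
    (hub : ∀ x y, P x y ≤ c₂ * ‖x - y‖ ^ (-((d : ℝ) + α))) (hc₂ : 0 ≤ c₂)
    (hQ0 : ∀ x y, Q 0 x y = if x = y then 1 else 0)
    (hQ : ∀ n x y, Q (n + 1) x y = ∑' z, Q n x z * P z y)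
    {β U : ℝ} (hβ : 0 < β) (hU : 0 ≤ U)
    (hT : ∀ (k : ℕ) (x : Fin d → ℤ) (r : ℝ), 1 ≤ k → 0 < r →
      ∑' z, {z | r < ‖z - x‖}.indicator (Q k x) z ≤ U * (k : ℝ) ^ (β / α) * r ^ (-β)) :
    ∃ C c : ℝ, 0 < C ∧ 0 < c ∧
      (∀ (n : ℕ) (x y : Fin d → ℤ), 1 ≤ n → Q n x y ≤ C * heatKernelShape d α n x y) ∧
      (∀ (n : ℕ) (x y : Fin d → ℤ), (2 ≤ n ∨ (n = 1 ∧ x ≠ y)) →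
        c * heatKernelShape d α n x y ≤ Q n x y) := by
  have hQnn : ∀ k x w, 0 ≤ Q k x w := kpow_nonneg hP0 hQ0 hQ
  set s : ℝ := (d : ℝ) + α with hs
  have hspos : 0 < s := by rw [hs]; positivity
  -- the four estimates
  obtain ⟨C_D, hCD, hdiag⟩ := kpow_diag_bound hd hα hP0 hP1 hμ hm hrev hlb hc₁ hQ0 hQ
  obtain ⟨C_O, hCO, hoff⟩ :=
    kpow_offdiag_bound hd hα hP0 hP1 hμ hm hrev hub hc₂ hQ0 hQ hCD.le hdiag hβ hU hT
  have htail := kpow_far_le_of_offdiag hd hα hP0 hP1 hQ0 hQ hCO.le hoff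
  have hCT : (0 : ℝ) ≤ max 1 (C_O * ((2 : ℝ) ^ α * (3 ^ d + 2 * d * 3 ^ (d - 1) / α))) :=
    le_trans zero_le_one (le_max_left _ _)
  obtain ⟨A'', hA''1, cO, hcO, hofflb⟩ :=
    kpow_offdiag_lower hd hα hP0 hP1 hμ hm hrev hlb hc₁ hub hc₂ hQ0 hQ hCT htail
  obtain ⟨cN, hcN, hnd⟩ := kpow_near_diag_lower hd hα hP0 hP1 hμ hm hrev hlb hc₁ hub hc₂ hQ0 hQ
    hCT htail (A' := A'') (by linarith)
  refine ⟨max C_D C_O, min (min cN cO) c₁, lt_of_lt_of_le hCD (le_max_left _ _),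
    lt_min (lt_min hcN hcO) hc₁, fun n x y hn => ?_, fun n x y hnxy => ?_⟩
  · -- upper bound
    have hn0 : (0 : ℝ) < n := by exact_mod_cast hn
    have hnq : 0 < (n : ℝ) ^ (-(d : ℝ) / α) := Real.rpow_pos_of_pos hn0 _
    have hd1 : Q n x y ≤ max C_D C_O * (n : ℝ) ^ (-(d : ℝ) / α) :=
      (hdiag n x y hn).trans (mul_le_mul_of_nonneg_right (le_max_left _ _) hnq.le)
    unfold heatKernelShape
    split_ifs with hxy
    · exact hd1
    · set D : ℝ := ‖x - y‖ with hDdef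
      have hD0 : 0 < D := norm_pos_iff.mpr (sub_ne_zero.mpr hxy)
      have hDs : (n : ℝ) / D ^ s = n * D ^ (-s) := by
        rw [Real.rpow_neg hD0.le, div_eq_mul_inv]
      rcases le_or_gt ((n : ℝ) ^ (1 / α)) D with hD | hD
      · have h2 : Q n x y ≤ max C_D C_O * ((n : ℝ) / D ^ s) := by
          rw [hDs]
          calc Q n x y ≤ C_O * n * D ^ (-s) := hoff n x y hn hD
            _ ≤ max C_D C_O * n * D ^ (-s) := by gcongr; exact le_max_right _ _
            _ = max C_D C_O * (n * D ^ (-s)) := by ring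
        calc Q n x y ≤ min (max C_D C_O * (n : ℝ) ^ (-(d : ℝ) / α)) (max C_D C_O * ((n : ℝ) / D ^ s)) :=
              le_min hd1 h2
          _ = max C_D C_O * min ((n : ℝ) ^ (-(d : ℝ) / α)) ((n : ℝ) / D ^ s) :=
              (mul_min_of_nonneg _ _ (le_trans hCD.le (le_max_left _ _))).symm
      · -- D < n^{1/α}: the minimum is the first term
        have hle : (n : ℝ) ^ (-(d : ℝ) / α) ≤ (n : ℝ) / D ^ s := by
          rw [hDs]
          have h1 : D ^ (-s) ≥ ((n : ℝ) ^ (1 / α)) ^ (-s) :=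
            Real.rpow_le_rpow_of_nonpos hD0 hD.le (by linarith)
          have h2 : ((n : ℝ) ^ (1 / α)) ^ (-s) = (n : ℝ) ^ (-s / α) := by
            rw [← Real.rpow_mul hn0.le]; congr 1; ring
          have h3 : (n : ℝ) * (n : ℝ) ^ (-s / α) = (n : ℝ) ^ (-(d : ℝ) / α) := by
            have : (n : ℝ) * (n : ℝ) ^ (-s / α) = (n : ℝ) ^ (1 : ℝ) * (n : ℝ) ^ (-s / α) := by
              rw [Real.rpow_one]
            rw [this, ← Real.rpow_add hn0]
            congr 1; rw [hs]; field_simp; ring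
          calc (n : ℝ) ^ (-(d : ℝ) / α) = n * ((n : ℝ) ^ (1 / α)) ^ (-s) := by rw [h2, h3]
            _ ≤ n * D ^ (-s) := mul_le_mul_of_nonneg_left h1 hn0.le
        rw [min_eq_left hle]
        exact hd1
  · -- lower bound
    have hc_le_cN : min (min cN cO) c₁ ≤ cN := (min_le_left _ _).trans (min_le_left _ _)
    have hc_le_cO : min (min cN cO) c₁ ≤ cO := (min_le_left _ _).trans (min_le_right _ _)
    have hc_le_c₁ : min (min cN cO) c₁ ≤ c₁ := min_le_right _ _
    have hc0 : 0 ≤ min (min cN cO) c₁ := (lt_min (lt_min hcN hcO) hc₁).le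
    rcases hnxy with hn2 | ⟨hn1, hxy⟩
    · have hn0 : (0 : ℝ) < n := by exact_mod_cast (by omega : 0 < n)
      have hnq : 0 < (n : ℝ) ^ (-(d : ℝ) / α) := Real.rpow_pos_of_pos hn0 _
      have hnα : 0 ≤ A'' * (n : ℝ) ^ (1 / α) := by positivity
      unfold heatKernelShape
      split_ifs with hxy
      · subst hxy
        calc min (min cN cO) c₁ * (n : ℝ) ^ (-(d : ℝ) / α) ≤ cN * (n : ℝ) ^ (-(d : ℝ) / α) := by
              gcongr
          _ ≤ Q n x x := hnd n x x hn2 (by rw [sub_self, norm_zero]; exact hnα)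
      · set D : ℝ := ‖x - y‖ with hDdef
        have hD0 : 0 < D := norm_pos_iff.mpr (sub_ne_zero.mpr hxy)
        rcases le_or_gt D (A'' * (n : ℝ) ^ (1 / α)) with hD | hD
        · calc min (min cN cO) c₁ * min ((n : ℝ) ^ (-(d : ℝ) / α)) ((n : ℝ) / D ^ s)
              ≤ cN * (n : ℝ) ^ (-(d : ℝ) / α) :=
                mul_le_mul hc_le_cN (min_le_left _ _) (le_min hnq.le (by positivity)) hcN.le
            _ ≤ Q n x y := hnd n x y hn2 hD
        · calc min (min cN cO) c₁ * min ((n : ℝ) ^ (-(d : ℝ) / α)) ((n : ℝ) / D ^ s)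
              ≤ cO * ((n : ℝ) / D ^ s) :=
                mul_le_mul hc_le_cO (min_le_right _ _) (le_min hnq.le (by positivity)) hcO.le
            _ = cO * n * D ^ (-s) := by rw [Real.rpow_neg hD0.le, div_eq_mul_inv]; ring
            _ ≤ Q n x y := hofflb n x y hn2 hD.le
    · subst hn1
      have hPs : ∀ x, Summable (P x) := fun x => (hP1 x).summable
      unfold heatKernelShape
      rw [if_neg hxy]
      set D : ℝ := ‖x - y‖ with hDdef
      have hD0 : 0 < D := norm_pos_iff.mpr (sub_ne_zero.mpr hxy)
      calc min (min cN cO) c₁ * min (((1 : ℕ) : ℝ) ^ (-(d : ℝ) / α)) (((1 : ℕ) : ℝ) / D ^ s)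
          ≤ c₁ * (((1 : ℕ) : ℝ) / D ^ s) :=
            mul_le_mul hc_le_c₁ (min_le_right _ _)
              (le_min (Real.rpow_nonneg (by norm_num) _) (by positivity)) hc₁.le
        _ = c₁ * D ^ (-s) := by rw [Nat.cast_one, one_div, Real.rpow_neg hD0.le]
        _ ≤ P x y := hlb x y
        _ = Q 1 x y := (kpow_one hQ0 hQ x y).symm

/-- **Bass–Levin 2002, Theorem 1.1** — discharge of the named fact `bassLevin_thm_1_1`:
two-sided bounds `c₂ (n^{-d/α} ∧ n‖x−y‖^{-(d+α)}) ≤ p(n,x,y) ≤ c₁ (n^{-d/α} ∧ n‖x−y‖^{-(d+α)})`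
for the symmetric stable-like jump chain on `ℤ^d` (upper bound for `n ≥ 1`; lower bound for
`n ≥ 2`, and for `n = 1` when `x ≠ y`). Proof: `exists_kernel_package` (eq. (2.1)),
`kpow_diag_bound` (Thm 4.3, discrete Nash/CKS), `tail_bound` (Nash's moment bound, replacing
Thm 2.8) and `kpow_two_sided_of_tight` (Thm 4.9, Prop. 5.1, Thm 5.2 via Meyer's truncation,
iterated annulus crossings and the overlap/Cauchy–Schwarz argument, replacing the parabolic
Harnack inequality Thm 3.1). [cite: BassLevin2002, Thm 1.1] -/
theorem bassLevin_thm_1_1_holds : bassLevin_thm_1_1 := by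
  intro d α κ C hd hα hα2 hκ hC0 hCs hCsum hCb
  obtain ⟨m, M, c₁, c₂, hm, -, hc₁, hc₁₂, hμ, hP0, hP1, hrev, hlb, hub⟩ :=
    exists_kernel_package hd hα hκ hC0 hCs hCsum hCb
  have hc₂ : 0 ≤ c₂ := hc₁.le.trans hc₁₂
  have hQ0 := jumpChainProb_zero C
  have hQ := jumpChainProb_succ C
  -- on-diagonal bound and Nash's tail bound
  obtain ⟨C_D, hCD, hdiag⟩ := kpow_diag_bound hd hα hP0 hP1 hμ hm hrev hlb hc₁ hQ0 hQ
  obtain ⟨U, hU, htail⟩ :=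
    tail_bound hd hα hα2 hP0 hP1 hμ hm hrev hlb hc₁ hub hc₂ hQ0 hQ hCD hdiag
  -- tightness with rate β = α/4 in the form consumed by `kpow_two_sided_of_tight`
  have hβ : 0 < α / 4 := by positivity
  have hT : ∀ (k : ℕ) (x : Fin d → ℤ) (r : ℝ), 1 ≤ k → 0 < r →
      ∑' z, {z | r < ‖z - x‖}.indicator (jumpChainProb C k x) z ≤
        U * (k : ℝ) ^ (α / 4 / α) * r ^ (-(α / 4)) := by
    intro k x r hk hr
    have hk0 : (0 : ℝ) ≤ k := Nat.cast_nonneg k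
    have hexp : α / 4 / α = (1 : ℝ) / 4 := by field_simp
    calc ∑' z, {z | r < ‖z - x‖}.indicator (jumpChainProb C k x) z
        ≤ U * (k : ℝ) ^ ((1 : ℝ) / 4) * (1 + r) ^ (-(α / 4)) := htail k x r hk hr.le
      _ ≤ U * (k : ℝ) ^ ((1 : ℝ) / 4) * r ^ (-(α / 4)) := by
          refine mul_le_mul_of_nonneg_left ?_ (mul_nonneg hU.le (Real.rpow_nonneg hk0 _))
          exact Real.rpow_le_rpow_of_nonpos hr (by linarith) (by linarith)
      _ = U * (k : ℝ) ^ (α / 4 / α) * r ^ (-(α / 4)) := by rw [hexp]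
  obtain ⟨C', c, hC', hc, hUB, hLB⟩ := kpow_two_sided_of_tight hd hα hP0 hP1 hμ hm hrev hlb hc₁
    hub hc₂ hQ0 hQ hβ hU.le hT
  exact ⟨C', c, hC', hc, hUB, hLB⟩

end Literature.Probability.Process
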